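import Literature.NumberTheory.Automorphic.SLTwoTreeQuadraticTorusFixedShells   -- ★ part I (A-p17 (g23), R1LL-WILD (W′1)) p843889: the stabiliser test, LL (2.1), fixed shells
import HarnessLib

/-!
# The non-split quadratic torus on the tree of `SL₂(F)`, II: the SHELL DECOMPOSITION and the uniqueness of the shell index (Labesse–Langlands 1979, §2 p. 8)

Topic `NumberTheory/Automorphic`; namespace `Literature.NumberTheory.Automorphic.HermitianLatticeTree` (ROAD W's).  KERNEL mathematics only: theorems, no definition, no
named fact, no instance, no notation, no `sorry`.  Cell `pub/hodgecm-mathlib` (D-0151), crux H413 = `stmt-HodgeConjecture-24833`, line «N6nsGerm», the WILDLY RAMIFIED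
residue «R1-CM-ram-wild» of books row #159 ∕ #165 — opportunistic brick **«R1LL-WILD (W′1)» «THE TORUS IN THE TREE»**, part II (A-p12 (g19)'s census
`F0/P3a/A-p12/g19/CENSUS-R1LL-wild.A-p12g19.md` §2; LEAD F0P3a-plan (g10) WORD T9-22 (4); seat A-p17 (g23), census `A-provers/A-p17/g23/CENSUS-W1prime-TorusInTree.A-p17g23.md`).
Part I = ★ `SLTwoTreeQuadraticTorusFixedShells` (same seat): the stabiliser test, LL (2.1), the fixed shells.
HONEST LABEL: HC_CM is proved only modulo the cell's 2 remaining named inputs (hLiu418, h413) until rung 0 closes; nothing printed is asserted here — elementary lattice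
algebra over a discrete valuation ring.

THE MATHEMATICS (notation of part I: `X` the tree of `SL₂(F)`, root `v₀ = 𝒪²`, torus `T = {(c, dv; d, c + du)}` = the regular representation of `F[τ]^×`, `τ² = uτ + v`,
shell representatives `g_m = diag(1, ϖ^m)`).
* §4 **SHELL DECOMPOSITION** `exists_torus_shell_eq`: under the ONE F-side non-split ∕ integral-basis binder `hE : |p² + p q u − q² v| ≤ 1 ⇒ p, q ∈ 𝒪` («`|N(p + qτ)| ≤ 1
  ⇒ p + qτ ∈ 𝒪 ⊕ 𝒪τ`», i.e. `{1, τ}` is an `𝒪`-basis of the valuation ring of the FIELD `E = F(τ)` at its unique place over `F`'s; it implies anisotropy,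
  `eq_zero_of_quadNormForm_eq_zero`), **every vertex is `t · g_m · v₀`** for a torus element `t ∈ GL₂(F)` and an `m : ℕ` — the double cosets `T ∖ GL₂(F) ∕ F^× GL₂(𝒪)` are
  indexed by `ℕ` with representatives `diag(1, ϖ^m)` [LL79 p. 8: `δ_m`, «representatives `(1 0; 0 ϖ^m)`»].  Proof (`exists_torus_shell_eq_of_le`): the columns `z₀, z₁ ∈ E`
  of `g`; if `|N z₁| ≤ |N z₀|` then `t_{z₀}⁻¹ g = (1, r; 0, s)` with `r + sτ = z̄₀ z₁ ∕ N z₀ = z₁ ∕ z₀`, whose norm `N z₁ ∕ N z₀` has valuation `≤ 1`, so `r, s ∈ 𝒪` by `hE`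
  and `(1, r; 0, s) = diag(1, ϖ^{ord s}) · diag(1, w) · (1, r; 0, 1)` with the last two factors in `GL₂(𝒪)`; otherwise swap the columns (`(0 1; 1 0) ∈ GL₂(𝒪)` fixes `v₀`).
* §5 **UNIQUENESS OF THE SHELL INDEX** `torus_shell_unique`: `t g_m · v₀ = t′ g_{m′} · v₀ ⇒ m = m′` (`u v ∈ 𝒪`, `v ≠ 0`), by the MULTIPLIER TEST
  `mapGL_torus_le_iff_isIntegralMatrix` («a torus `y` maps the lattice `t g_m · v₀` into itself iff `g_m⁻¹ y g_m` is integral» — invariant under torus translates and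
  homotheties) applied to `y_n = ϖ^n τ = (0, ϖ^n v; ϖ^n, ϖ^n u)`, which passes at shell `m` iff `m ≤ n`.  Hence the shells PARTITION the vertex set and «the shell of a
  vertex» is well defined without a definition (consumers destructure `exists_torus_shell_eq` and compare with `torus_shell_unique`).
NOT here (neighbours' bricks): the class of `γ` at a fixed shell-`m` vertex modulo a level ((W′3)-ALG p08 (g15)), the weighted unfolding of orbital integrals over fixed
vertices ((W′2) B-p14 (g33)), shell cardinalities `δ_m` and the `κ`-cancellation over deep shells ((W′4) A-p12 (g19) ∕ A-p01 (g21)), the transport to the torus as it arrives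
through `ρ : U(Φ₂)(E_w) → PGL₂(F_v)` ((W′6)).

## References
* [LabesseLanglands1979] J.-P. Labesse, R. P. Langlands, *L-indistinguishability for SL(2)*, Canad. J. Math. 31 (1979), §2 pp. 7–8.
* [Serre1980Trees] J.-P. Serre, *Trees* (1980), Ch. II §1.1 Theorem 1, §1.2–§1.3.
* [BruhatTits1972] F. Bruhat, J. Tits, *Groupes réductifs sur un corps local I*, Publ. IHÉS 41 (1972), §10.
-/

set_option autoImplicit false

noncomputable section

open scoped ValuativeRel Matrix MatrixGroups
open Matrix ValuativeRel

namespace Literature.NumberTheory.Automorphic.HermitianLatticeTree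

open Literature.NumberTheory.Automorphic Literature.NumberTheory.LocalFields

variable {F : Type*} [Field F] [ValuativeRel F] {ϖ : F} (hϖ : IsUniformizingElement ϖ) [IsDiscreteValuationRing 𝒪[F]]

/-! ## §4 THE SHELL DECOMPOSITION `X = ⨆_{m ∈ ℕ} T · g_m · v₀` (LL79 p. 8: the double cosets `T ∖ G ∕ F^× GL₂(𝒪)`) -/

omit [ValuativeRel F] [IsDiscreteValuationRing 𝒪[F]] in
/-- Scaling the argument of the norm form: `N(λp, λq) = λ² N(p, q)`. [cite: LabesseLanglands1979, §2 p. 7] -/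
theorem quadNormForm_smul (u v p q l : F) : (l * p) ^ 2 + (l * p) * (l * q) * u - (l * q) ^ 2 * v = l ^ 2 * (p ^ 2 + p * q * u - q ^ 2 * v) := by
  ring

include hϖ in
omit [IsDiscreteValuationRing 𝒪[F]] in
/-- **THE NON-SPLIT HYPOTHESIS IMPLIES ANISOTROPY**: if `|N(p + qτ)| ≤ 1` forces `p, q ∈ 𝒪`, then `N(p + qτ) = 0` forces `p = q = 0` (scale a non-trivial zero by `(ϖ p)⁻¹`).
[cite: LabesseLanglands1979, §2 p. 7] -/
theorem eq_zero_of_quadNormForm_eq_zero {u v : F} (hE : ∀ p q : F, valuation F (p ^ 2 + p * q * u - q ^ 2 * v) ≤ 1 → p ∈ 𝒪[F] ∧ q ∈ 𝒪[F]) {p q : F}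
    (h : p ^ 2 + p * q * u - q ^ 2 * v = 0) : p = 0 ∧ q = 0 := by
  have h0 := hϖ.ne_zero
  have hϖinv : ϖ⁻¹ ∉ 𝒪[F] := by
    rw [Valuation.mem_integer_iff, map_inv₀, not_le]
    exact one_lt_inv_iff₀.2 ⟨(Valuation.pos_iff _).2 h0, hϖ.valuation_lt_one⟩
  have key : ∀ l : F, l * p ∈ 𝒪[F] ∧ l * q ∈ 𝒪[F] := fun l => hE (l * p) (l * q) (by rw [quadNormForm_smul, h, mul_zero, map_zero]; exact zero_le_one)
  constructor
  · by_contra hp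
    have := (key (ϖ * p)⁻¹).1
    rw [show (ϖ * p)⁻¹ * p = ϖ⁻¹ by field_simp] at this
    exact hϖinv this
  · by_contra hq
    have := (key (ϖ * q)⁻¹).2
    rw [show (ϖ * q)⁻¹ * q = ϖ⁻¹ by field_simp] at this
    exact hϖinv this

include hϖ in
/-- `GL₂(𝒪)` fixes the root: `k · v₀ = v₀` for `k ∈ GL₂(𝒪)`. [cite: Serre1980Trees, Ch. II §1.3] -/
theorem glVertexAct_root_eq_of_mem_glInt {k : GL (Fin 2) F} (hk : k ∈ glInt 2 F)
    (v₀ : {M : Submodule 𝒪[F] (Fin 2 → F) // IsSpecialLattice (RingHom.id F) ϖ !![(0 : F), 1; -1, 0] M})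
    (hv₀ : v₀.1 = latt (1 : Matrix (Fin 2) (Fin 2) F)) : glVertexAct hϖ k v₀ = v₀ := by
  refine (glVertexAct_eq_iff hϖ k v₀ v₀).2 ⟨0, ?_⟩
  have h := latt_mul_of_mem_glInt 1 k hk
  rw [one_mul, Units.val_one] at h
  rw [zpow_zero, scaleLattice_one, hv₀, mapGL_latt_one, h]

omit [IsDiscreteValuationRing 𝒪[F]] in
/-- The unipotent `(1, r; 0, 1)` with `r ∈ 𝒪` is an element of `GL₂(𝒪)` (with the stated matrix). [cite: Serre1980Trees, Ch. II §1.1] -/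
theorem exists_mem_glInt_coe_eq_unipotent {r : F} (hr : r ∈ 𝒪[F]) :
    ∃ U : GL (Fin 2) F, (U : Matrix (Fin 2) (Fin 2) F) = !![1, r; 0, 1] ∧ U ∈ glInt 2 F := by
  have hdet : (!![(1 : F), r; 0, 1]).det = 1 := by rw [Matrix.det_fin_two_of]; ring
  refine ⟨Matrix.GeneralLinearGroup.mk'' _ (isUnit_iff_ne_zero.2 (hdet.symm ▸ one_ne_zero : (!![(1 : F), r; 0, 1]).det ≠ 0)), rfl,
    mem_glInt_of_isIntegralMatrix (fun i j => ?_) ?_⟩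
  · show !![(1 : F), r; 0, 1] i j ∈ 𝒪[F]
    fin_cases i <;> fin_cases j
    · exact one_mem _
    · exact hr
    · exact zero_mem _
    · exact one_mem _
  · show valuation F (!![(1 : F), r; 0, 1]).det = 1
    rw [hdet, map_one]

omit [IsDiscreteValuationRing 𝒪[F]] in
/-- The column swap `(0, 1; 1, 0)` as an element of `GL₂(𝒪)`. [cite: Serre1980Trees, Ch. II §1.1] -/
theorem exists_mem_glInt_coe_eq_swap :
    ∃ W : GL (Fin 2) F, (W : Matrix (Fin 2) (Fin 2) F) = !![0, 1; 1, 0] ∧ W ∈ glInt 2 F := by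
  have hdet : (!![(0 : F), 1; 1, 0]).det = -1 := by rw [Matrix.det_fin_two_of]; ring
  have hne : (!![(0 : F), 1; 1, 0]).det ≠ 0 := by rw [hdet]; exact neg_ne_zero.2 one_ne_zero
  exact ⟨Matrix.GeneralLinearGroup.mk'' _ (isUnit_iff_ne_zero.2 hne), rfl, mem_glInt_of_coe_eq_antidiag _ rfl⟩

include hϖ in
/-- **THE SHELL OF `g · v₀` WHEN THE SECOND COLUMN IS THE SMALLER ONE.**  Write the columns of `g` as `z₀ = p₀ + q₀τ`, `z₁ = p₁ + q₁τ`; if `|N z₁| ≤ |N z₀|` then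
`g · v₀ = t_{z₀} · g_m · v₀` with `t_{z₀} = (p₀, q₀v; q₀, p₀ + q₀u)` the torus element of `z₀` and `m = ord s`, where `t_{z₀}⁻¹ g = (1, r; 0, s)` and `r + sτ = z̄₀ z₁ ∕ N z₀
= z₁ ∕ z₀` is INTEGRAL by the non-split hypothesis (`|N(z₁∕z₀)| ≤ 1`). [cite: LabesseLanglands1979, §2 p. 8] [cite: Serre1980Trees, Ch. II §1.1 Theorem 1] -/
theorem exists_torus_shell_eq_of_le {u v : F} (hE : ∀ p q : F, valuation F (p ^ 2 + p * q * u - q ^ 2 * v) ≤ 1 → p ∈ 𝒪[F] ∧ q ∈ 𝒪[F])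
    {g : GL (Fin 2) F} {p₀ p₁ q₀ q₁ : F} (hg : (g : Matrix (Fin 2) (Fin 2) F) = !![p₀, p₁; q₀, q₁])
    (hle : valuation F (p₁ ^ 2 + p₁ * q₁ * u - q₁ ^ 2 * v) ≤ valuation F (p₀ ^ 2 + p₀ * q₀ * u - q₀ ^ 2 * v))
    (v₀ : {M : Submodule 𝒪[F] (Fin 2 → F) // IsSpecialLattice (RingHom.id F) ϖ !![(0 : F), 1; -1, 0] M})
    (hv₀ : v₀.1 = latt (1 : Matrix (Fin 2) (Fin 2) F)) :
    ∃ (t gm : GL (Fin 2) F) (m : ℕ), (t : Matrix (Fin 2) (Fin 2) F) = !![p₀, q₀ * v; q₀, p₀ + q₀ * u] ∧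
      (gm : Matrix (Fin 2) (Fin 2) F) = Matrix.diagonal ![1, ϖ ^ m] ∧ glVertexAct hϖ g v₀ = glVertexAct hϖ (t * gm) v₀ := by
  have h0 := hϖ.ne_zero
  -- the norm `N₀ = N z₀` is non-zero (anisotropy + `det g ≠ 0`)
  set N₀ : F := p₀ ^ 2 + p₀ * q₀ * u - q₀ ^ 2 * v with hN₀
  have hdetg : (g : Matrix (Fin 2) (Fin 2) F).det ≠ 0 := (g.isUnit.map Matrix.detMonoidHom).ne_zero
  have hN₀0 : N₀ ≠ 0 := by
    intro hN
    obtain ⟨hp, hq⟩ := eq_zero_of_quadNormForm_eq_zero hϖ hE hN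
    apply hdetg
    rw [hg, Matrix.det_fin_two_of, hp, hq, zero_mul, mul_zero, sub_zero]
  -- the torus element `t = t_{z₀}`
  have hdett : (!![p₀, q₀ * v; q₀, p₀ + q₀ * u]).det ≠ 0 := by rw [QuadraticRegularRep.det_regRep]; exact hN₀0
  set t : GL (Fin 2) F := Matrix.GeneralLinearGroup.mk'' _ (isUnit_iff_ne_zero.2 hdett) with ht
  have htcoe : (t : Matrix (Fin 2) (Fin 2) F) = !![p₀, q₀ * v; q₀, p₀ + q₀ * u] := rfl
  -- `t⁻¹ g = (1, r; 0, s)`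
  set r : F := ((p₀ + q₀ * u) * p₁ - q₀ * v * q₁) / N₀ with hr
  set s : F := (p₀ * q₁ - q₀ * p₁) / N₀ with hs
  have e1 : p₀ * r + q₀ * v * s = p₁ := by rw [hr, hs]; field_simp; ring
  have e2 : q₀ * r + (p₀ + q₀ * u) * s = q₁ := by rw [hr, hs]; field_simp; ring
  have htM : (t : Matrix (Fin 2) (Fin 2) F) * !![1, r; 0, s] = (g : Matrix (Fin 2) (Fin 2) F) := by
    rw [htcoe, hg, Matrix.mul_fin_two, mul_one, mul_zero, add_zero, mul_one, mul_zero, add_zero, e1, e2]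
  have hh : ((t⁻¹ * g : GL (Fin 2) F) : Matrix (Fin 2) (Fin 2) F) = !![1, r; 0, s] := by
    rw [Units.val_mul, Matrix.coe_units_inv, ← htM, ← Matrix.mul_assoc, htcoe, Matrix.nonsing_inv_mul _ (isUnit_iff_ne_zero.2 hdett),
      Matrix.one_mul]
  -- `N(r + sτ) = N z₁ ∕ N z₀` has valuation `≤ 1`, so `r, s ∈ 𝒪`
  have hrsN : r ^ 2 + r * s * u - s ^ 2 * v = (p₁ ^ 2 + p₁ * q₁ * u - q₁ ^ 2 * v) / N₀ := by
    rw [hr, hs]; field_simp; ring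
  have hrs : r ∈ 𝒪[F] ∧ s ∈ 𝒪[F] := by
    refine hE r s ?_
    rw [hrsN, map_div₀]
    exact div_le_one_of_le₀ hle zero_le
  -- `s ≠ 0` (it is `det (t⁻¹ g)`) and `s = ϖ^m w`
  have hs0 : s ≠ 0 := by
    intro hs0
    apply ((t⁻¹ * g).isUnit.map Matrix.detMonoidHom).ne_zero
    show ((t⁻¹ * g : GL (Fin 2) F) : Matrix (Fin 2) (Fin 2) F).det = 0
    rw [hh, Matrix.det_fin_two_of, hs0]; ring
  obtain ⟨m, w, hw, hsw⟩ : ∃ (m : ℕ) (w : F), valuation F w = 1 ∧ s = ϖ ^ m * w := by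
    -- (★ `exists_eq_pow_mul_of_mem_integer` of `SatakeParametersGLXiRecursion`, re-derived from ★ `exists_eq_zpow_mul_of_ne_zero` to keep the import closure small)
    obtain ⟨a, w, hw, hsw⟩ := exists_eq_zpow_mul_of_ne_zero hϖ hs0
    have ha : 0 ≤ a := by
      by_contra ha
      rw [not_le] at ha
      have h1 : valuation F s ≤ 1 := (Valuation.mem_integer_iff _ _).1 hrs.2
      rw [hsw, map_mul, hw, mul_one, map_zpow₀] at h1
      have h2 : valuation F ϖ ^ (0 : ℤ) < valuation F ϖ ^ a := zpow_right_strictAnti₀ ((Valuation.pos_iff _).2 h0) hϖ.valuation_lt_one ha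
      rw [zpow_zero] at h2
      exact absurd h1 (not_le.2 h2)
    obtain ⟨m, rfl⟩ := Int.eq_ofNat_of_zero_le ha
    exact ⟨m, w, hw, by rw [hsw, zpow_natCast]⟩
  -- the factorisation `t⁻¹ g = g_m · diag(1, w) · (1, r; 0, 1)` with the last two factors in `GL₂(𝒪)`
  have hdetgm : (Matrix.diagonal ![(1 : F), ϖ ^ m]).det ≠ 0 := by
    rw [Matrix.det_diagonal, Fin.prod_univ_two]; simp [pow_ne_zero m h0]
  set gm : GL (Fin 2) F := Matrix.GeneralLinearGroup.mk'' _ (isUnit_iff_ne_zero.2 hdetgm) with hgm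
  have hgmcoe : (gm : Matrix (Fin 2) (Fin 2) F) = Matrix.diagonal ![1, ϖ ^ m] := rfl
  obtain ⟨D, hD, hDK, -⟩ := exists_mem_glInt_coe_eq_diagonal hw
  obtain ⟨U, hU, hUK⟩ := exists_mem_glInt_coe_eq_unipotent hrs.1
  have hfac : t⁻¹ * g = gm * (D * U) := by
    ext : 1
    rw [hh, Units.val_mul, Units.val_mul, hgmcoe, hD, hU, ← Matrix.mul_assoc, Matrix.diagonal_mul_diagonal]
    ext i j
    fin_cases i <;> fin_cases j <;> simp [Matrix.mul_apply, Fin.sum_univ_two, hsw]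
  refine ⟨t, gm, m, htcoe, hgmcoe, ?_⟩
  have hg' : g = t * gm * (D * U) := by rw [mul_assoc, ← hfac, mul_inv_cancel_left]
  rw [hg', glVertexAct_mul, glVertexAct_root_eq_of_mem_glInt hϖ (mul_mem hDK hUK) v₀ hv₀]

include hϖ in
/-- **THE SHELL DECOMPOSITION OF THE TREE UNDER A NON-SPLIT QUADRATIC TORUS** (LL79 p. 8: `G(F) = ⨆_{m ≥ 0} T(F) · diag(1, ϖ^m) · G(𝒪_F) F^×`): if `{1, τ}`
(`τ² = uτ + v`) is an integral basis at a non-split place — ONE F-side binder `hE : |p² + p q u − q² v| ≤ 1 ⇒ p, q ∈ 𝒪` — then EVERY vertex of the tree of `SL₂(F)` is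
`t · diag(1, ϖ^m) · v₀` for a torus element `t = (c, dv; d, c + du) ∈ GL₂(F)` and an `m : ℕ`: the vertices are organised in SHELLS `m = 0, 1, 2, …` about the facet of
`T`, each shell one `T`-orbit.  Proof: `x = g · v₀` (★ `exists_glVertexAct_eq`); compare the norms of the two columns of `g` and apply `exists_torus_shell_eq_of_le`
to `g` or to `g · (0 1; 1 0)`. [cite: LabesseLanglands1979, §2 p. 8] [cite: Serre1980Trees, Ch. II §1.1 Theorem 1, §1.3] -/
theorem exists_torus_shell_eq {u v : F} (hE : ∀ p q : F, valuation F (p ^ 2 + p * q * u - q ^ 2 * v) ≤ 1 → p ∈ 𝒪[F] ∧ q ∈ 𝒪[F])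
    (v₀ : {M : Submodule 𝒪[F] (Fin 2 → F) // IsSpecialLattice (RingHom.id F) ϖ !![(0 : F), 1; -1, 0] M})
    (hv₀ : v₀.1 = latt (1 : Matrix (Fin 2) (Fin 2) F))
    (x : {M : Submodule 𝒪[F] (Fin 2 → F) // IsSpecialLattice (RingHom.id F) ϖ !![(0 : F), 1; -1, 0] M}) :
    ∃ (t gm : GL (Fin 2) F) (c d : F) (m : ℕ), (t : Matrix (Fin 2) (Fin 2) F) = !![c, d * v; d, c + d * u] ∧
      (gm : Matrix (Fin 2) (Fin 2) F) = Matrix.diagonal ![1, ϖ ^ m] ∧ x = glVertexAct hϖ (t * gm) v₀ := by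
  obtain ⟨g, rfl⟩ := exists_glVertexAct_eq hϖ v₀ hv₀ x
  have hg : (g : Matrix (Fin 2) (Fin 2) F) = !![(g : Matrix (Fin 2) (Fin 2) F) 0 0, (g : Matrix (Fin 2) (Fin 2) F) 0 1;
      (g : Matrix (Fin 2) (Fin 2) F) 1 0, (g : Matrix (Fin 2) (Fin 2) F) 1 1] := Matrix.eta_fin_two _
  set p₀ := (g : Matrix (Fin 2) (Fin 2) F) 0 0
  set p₁ := (g : Matrix (Fin 2) (Fin 2) F) 0 1
  set q₀ := (g : Matrix (Fin 2) (Fin 2) F) 1 0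
  set q₁ := (g : Matrix (Fin 2) (Fin 2) F) 1 1
  rcases le_total (valuation F (p₁ ^ 2 + p₁ * q₁ * u - q₁ ^ 2 * v)) (valuation F (p₀ ^ 2 + p₀ * q₀ * u - q₀ ^ 2 * v)) with hle | hle
  · obtain ⟨t, gm, m, ht, hgm, heq⟩ := exists_torus_shell_eq_of_le hϖ hE hg hle v₀ hv₀
    exact ⟨t, gm, p₀, q₀, m, ht, hgm, heq⟩
  · -- swap the columns: `g · v₀ = (g W) · v₀`, `W = (0 1; 1 0) ∈ GL₂(𝒪)`
    obtain ⟨W, hW, hWK⟩ := exists_mem_glInt_coe_eq_swap (F := F)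
    have hgW : ((g * W : GL (Fin 2) F) : Matrix (Fin 2) (Fin 2) F) = !![p₁, p₀; q₁, q₀] := by
      rw [Units.val_mul, hg, hW, Matrix.mul_fin_two]
      ext i j
      fin_cases i <;> fin_cases j <;> simp
    obtain ⟨t, gm, m, ht, hgm, heq⟩ := exists_torus_shell_eq_of_le hϖ hE hgW hle v₀ hv₀
    refine ⟨t, gm, p₁, q₁, m, ht, hgm, ?_⟩
    rw [← heq, glVertexAct_mul, glVertexAct_root_eq_of_mem_glInt hϖ hWK v₀ hv₀]

/-! ## §5 UNIQUENESS OF THE SHELL INDEX (LL79 p. 8: «it is clear that `m` is uniquely determined») -/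

include hϖ in
/-- **THE MULTIPLIER TEST.**  For a shell-`m` vertex `x = t g_m · v₀` and ANY torus element `y ∈ GL₂(F)`: `y` maps the lattice `x` INTO itself iff `g_m⁻¹ y g_m` is integral
— independently of the torus translate `t` and of the homothety normalising `x` (the multiplier order of a lattice is an invariant of its `T F^×`-orbit).
[cite: LabesseLanglands1979, §2 p. 8] [cite: Serre1980Trees, Ch. II §1.1] -/
theorem mapGL_torus_le_iff_isIntegralMatrix {u v c d c' d' : F} {y t gm : GL (Fin 2) F} (hy : (y : Matrix (Fin 2) (Fin 2) F) = !![c', d' * v; d', c' + d' * u])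
    (ht : (t : Matrix (Fin 2) (Fin 2) F) = !![c, d * v; d, c + d * u])
    (v₀ : {M : Submodule 𝒪[F] (Fin 2 → F) // IsSpecialLattice (RingHom.id F) ϖ !![(0 : F), 1; -1, 0] M})
    (hv₀ : v₀.1 = latt (1 : Matrix (Fin 2) (Fin 2) F)) :
    mapGL y (glVertexAct hϖ (t * gm) v₀).1 ≤ (glVertexAct hϖ (t * gm) v₀).1 ↔ IsIntegralMatrix ((gm⁻¹ * y * gm : GL (Fin 2) F) : Matrix (Fin 2) (Fin 2) F) := by
  have h0 := hϖ.ne_zero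
  obtain ⟨k, hk⟩ := exists_coe_glVertexAct_root_eq hϖ (t * gm) v₀ hv₀
  rw [hk, mapGL_scaleLattice, scaleLattice_le_scaleLattice_iff (zpow_ne_zero k h0), mapGL_latt, latt_le_latt_iff, _root_.mul_inv_rev,
    show gm⁻¹ * t⁻¹ * (y * (t * gm)) = gm⁻¹ * (t⁻¹ * y * t) * gm by simp only [mul_assoc], quadTorus_inv_mul_mul_eq hy ht]

include hϖ in
omit [IsDiscreteValuationRing 𝒪[F]] in
/-- The test elements: `y_n = ϖ^n τ = (0, ϖ^n v; ϖ^n, ϖ^n u)` maps the shell-`m` lattice into itself iff `m ≤ n` (for `u, v ∈ 𝒪`). [cite: LabesseLanglands1979, §2 p. 8] -/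
theorem isIntegralMatrix_shellConj_tau_iff {u v : F} (hu : u ∈ 𝒪[F]) (hv : v ∈ 𝒪[F]) {y gm : GL (Fin 2) F} {n m : ℕ}
    (hy : (y : Matrix (Fin 2) (Fin 2) F) = !![0, ϖ ^ n * v; ϖ ^ n, 0 + ϖ ^ n * u]) (hgm : (gm : Matrix (Fin 2) (Fin 2) F) = Matrix.diagonal ![1, ϖ ^ m]) :
    IsIntegralMatrix ((gm⁻¹ * y * gm : GL (Fin 2) F) : Matrix (Fin 2) (Fin 2) F) ↔ m ≤ n := by
  have h0 := hϖ.ne_zero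
  rw [coe_inv_mul_torus_mul_of_coe_eq_diagonal u v 0 (ϖ ^ n) hy hgm (pow_ne_zero m h0),
    isIntegralMatrix_shellConj_iff hu hv (zero_mem _) (hϖ.pow_mem n) (hϖ.pow_mem m) (pow_ne_zero m h0), map_pow, map_pow]
  exact pow_le_pow_iff_right_of_lt_one₀ ((Valuation.pos_iff _).2 h0) hϖ.valuation_lt_one

omit [ValuativeRel F] [IsDiscreteValuationRing 𝒪[F]] in
/-- The test element `(0, ϖ^n v; ϖ^n, ϖ^n u)` is invertible when `v ≠ 0` (its determinant is `−ϖ^{2n} v`). [cite: LabesseLanglands1979, §2 p. 7] -/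
theorem exists_coe_eq_shellTest {v : F} (u : F) (hϖ0 : ϖ ≠ 0) (hv0 : v ≠ 0) (n : ℕ) :
    ∃ y : GL (Fin 2) F, (y : Matrix (Fin 2) (Fin 2) F) = !![0, ϖ ^ n * v; ϖ ^ n, 0 + ϖ ^ n * u] := by
  have hdet : (!![(0 : F), ϖ ^ n * v; ϖ ^ n, 0 + ϖ ^ n * u]).det ≠ 0 := by
    rw [QuadraticRegularRep.det_regRep]
    have : (0 : F) ^ 2 + 0 * ϖ ^ n * u - (ϖ ^ n) ^ 2 * v = -((ϖ ^ n) ^ 2 * v) := by ring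
    rw [this, neg_ne_zero]
    exact mul_ne_zero (pow_ne_zero 2 (pow_ne_zero n hϖ0)) hv0
  exact ⟨Matrix.GeneralLinearGroup.mk'' _ (isUnit_iff_ne_zero.2 hdet), rfl⟩

include hϖ in
/-- **UNIQUENESS OF THE SHELL INDEX**: if `t g_m · v₀ = t′ g_{m′} · v₀` for torus elements `t, t′` then `m = m′` (for `u, v ∈ 𝒪`, `v ≠ 0` — e.g. under the non-split
hypothesis of `exists_torus_shell_eq`, by `eq_zero_of_quadNormForm_eq_zero`).  With §4: the shells `T · g_m · v₀`, `m ∈ ℕ`, PARTITION the vertex set, and `m` is a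
well-defined function of the vertex («`ord` of the conductor of its multiplier order»). [cite: LabesseLanglands1979, §2 p. 8] [cite: Serre1980Trees, Ch. II §1.1 Theorem 1] -/
theorem torus_shell_unique {u v c d c' d' : F} (hu : u ∈ 𝒪[F]) (hv : v ∈ 𝒪[F]) (hv0 : v ≠ 0) {t t' gm gm' : GL (Fin 2) F} {m m' : ℕ}
    (ht : (t : Matrix (Fin 2) (Fin 2) F) = !![c, d * v; d, c + d * u]) (ht' : (t' : Matrix (Fin 2) (Fin 2) F) = !![c', d' * v; d', c' + d' * u])
    (hgm : (gm : Matrix (Fin 2) (Fin 2) F) = Matrix.diagonal ![1, ϖ ^ m]) (hgm' : (gm' : Matrix (Fin 2) (Fin 2) F) = Matrix.diagonal ![1, ϖ ^ m'])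
    (v₀ : {M : Submodule 𝒪[F] (Fin 2 → F) // IsSpecialLattice (RingHom.id F) ϖ !![(0 : F), 1; -1, 0] M})
    (hv₀ : v₀.1 = latt (1 : Matrix (Fin 2) (Fin 2) F)) (h : glVertexAct hϖ (t * gm) v₀ = glVertexAct hϖ (t' * gm') v₀) : m = m' := by
  have h0 := hϖ.ne_zero
  obtain ⟨y, hy⟩ := exists_coe_eq_shellTest u h0 hv0 m
  obtain ⟨y', hy'⟩ := exists_coe_eq_shellTest u h0 hv0 m'
  have h1 := (isIntegralMatrix_shellConj_tau_iff hϖ hu hv hy hgm).2 le_rfl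
  rw [← mapGL_torus_le_iff_isIntegralMatrix hϖ hy ht v₀ hv₀, h, mapGL_torus_le_iff_isIntegralMatrix hϖ hy ht' v₀ hv₀,
    isIntegralMatrix_shellConj_tau_iff hϖ hu hv hy hgm'] at h1
  have h2 := (isIntegralMatrix_shellConj_tau_iff hϖ hu hv hy' hgm').2 le_rfl
  rw [← mapGL_torus_le_iff_isIntegralMatrix hϖ hy' ht' v₀ hv₀, ← h, mapGL_torus_le_iff_isIntegralMatrix hϖ hy' ht v₀ hv₀,
    isIntegralMatrix_shellConj_tau_iff hϖ hu hv hy' hgm] at h2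
  exact le_antisymm h2 h1

include hϖ in
omit [IsDiscreteValuationRing 𝒪[F]] in
/-- Under the non-split hypothesis, `v ≠ 0` (the norm of `τ` is `−v`). [cite: LabesseLanglands1979, §2 p. 7] -/
theorem ne_zero_of_quadNormForm_integral {u v : F} (hE : ∀ p q : F, valuation F (p ^ 2 + p * q * u - q ^ 2 * v) ≤ 1 → p ∈ 𝒪[F] ∧ q ∈ 𝒪[F]) : v ≠ 0 := by
  intro hv
  have h := (eq_zero_of_quadNormForm_eq_zero hϖ hE (p := 0) (q := 1) (by rw [hv]; ring)).2
  exact one_ne_zero h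

end Literature.NumberTheory.Automorphic.HermitianLatticeTree

end
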